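import Summits.ResolutionOfSingularities.ResolutionOfSingularities.Theorems.FrobeniusClosingSteerDivisorTriggerTwoChart
import Literature.AlgebraicGeometry.Resolution.RsopMonomialIdeals
import HarnessLib

/-!
# B13a-1′ — the HIGH point-step decomposition `f_{i+1} = x·ρ + G²`, `ρ ∈ 𝔪²` (p = 2)

W4.1, crux `Steer` (stmt-ResolutionOfSingularities-16345), route `FrobeniusClosing`, line `switching_dichotomy`, σ-residual
HIGH half, B13 slate (res-L0-w41-strat-2 STUBPLAN-B13.md §B13a-1 D1 + the graded lemma; delta rev 9/10
`L/res-L0-w41-strat-2/R2TwoSigma-s16-strat2.delta.lean` 11a4c8131b8ae2f9, stub **B13a-1′ `highPointStep_decomposition_two`**;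
res-L0-w41-plan-1 DEAL AMENDMENT 2026-08-27T07:57:36Z → res-type-076). Theses-free, def-free helper: the bodies of the
skeleton's `IsExcParamAlong` / `IsStrictStepAlong` / `IsHighOrderAt` / `IsPointStep` appear UNFOLDED as binders (the
by-name leaf is the holder's 8-line adapter over `highPointStep_decomposition_pointStep`, handed with this file).

## Statement (one step `R ⊂ R'` of a 2-steered run at a POINT stage, HIGH at both ends)

`K` a field of characteristic `2`, `O` a valuation ring of `K`, `R ⊆ K` a regular local subring dominated by `O`, `R'` the
local blowing up of `R` along `𝔪_R` with respect to `O` (`IsLocalBlowupAlong`), regular; `s = x₀·s' + g` the strict step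
(`x₀` an exceptional parameter = least-value element of `𝔪_R`, `g ∈ R`), `f = s² ∈ R`, `f' = s'² ∈ R'`; HIGH at the source
(`f − g₀² ∈ 𝔪_R³` for some `g₀`) and at the target (`f' − g₁² ∈ 𝔪_{R'}³` for some `g₁`). Then for EVERY exceptional
parameter `x` of the step, `x` is a regular parameter of `R'` (`x ∈ 𝔪_{R'} ∖ 𝔪_{R'}²`) and
`f' = x·ρ + G²` with `ρ ∈ 𝔪_{R'}²`, `G ∈ R'` (`sq_eq_mul_add_sq_of_high`; run-indexed form
`highPointStep_decomposition_pointStep`).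

## Proof

Chart of `x`: `R' = (R[𝔪_R/x])_{centre}`, `x ∉ 𝔪_R²` (domination), so `R'/(x)` is regular local
(`DivisorTrigger.isRegularRing_blowupRing_quotient` / `isRegularLocalRing_locAtCentre_quotient`), whence `x ∉ 𝔪_{R'}²`
(Matsumura 14.2, Remark: `IsRsopPart.of_isRegularLocalRing_quotient`). With `c = x₀/x` (a unit of `R'`):
`c² f' x² = f − g² = (f − g₀²) + (g − g₀)²`, `f − g₀² ∈ 𝔪_R³R' = x³R'`, valuations force `g − g₀ ∈ 𝔪_R`, so
`G₀ = (g − g₀)/x ∈ R'` and `c² f' = x·h + G₀²`. HIGH at the target gives `x·h + (G₀ − c g₁)² ∈ 𝔪_{R'}³`; the GRADED LEMMA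
(`exists_sub_mul_mem_sq`: in a regular local ring of characteristic `2` with `x ∈ 𝔪 ∖ 𝔪²`, `xρ + w² ∈ 𝔪³` forces
`w ≡ μx`, `ρ ≡ μ²x (mod 𝔪²)` — read in the regular ring `R/(x)`, where `w̄² ∈ 𝔪̄³` gives `w̄ ∈ 𝔪̄²` by the additivity of
the order, then `x(ρ − μ²x) ∈ 𝔪³` gives `ρ − μ²x ∈ 𝔪²` by the same additivity) moves `μ²x²` into the square:
`c² f' = x(h − μ²x) + (μx + G₀)²`, and `f' = x·ρ + G²` with `ρ = c⁻²(h − μ²x) ∈ 𝔪²`.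
OURS (the W4.1 engine; strat-2 STRAT2-MEMO-1 §4c, STUBPLAN-B13 §B13a-1 D1), standard commutative algebra; nothing here is a
statement of the manuscript under review [claim: Hironaka2017, status: under-review]; AI-produced, weaker than expert review.
[cite: Matsumura1987, Thm. 14.2, Thm. 17.10] [cite: ZariskiSamuel1960, Ch. VIII §1 Thm. 1] [cite: NovacoskiSpivakovsky2014, Def. 2.11]
-/

noncomputable section

-- `Summit.<S>.<S>.…` duplicates the summit name by design (single-problem summit).
set_option linter.dupNamespace false

open IsLocalRing Literature.AlgebraicGeometry.Resolution

namespace Summit.ResolutionOfSingularities.ResolutionOfSingularities.Theorems.SwitchingDichotomy.HighPointStep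

open Summit.ResolutionOfSingularities.ResolutionOfSingularities.Theorems.SwitchingDichotomy.DivisorTrigger
  (eq_locAtCentre_blowupRing isRegularRing_blowupRing_quotient isRegularLocalRing_locAtCentre_quotient)

/-! ## §1 Local algebra in a regular local ring -/

section LocalAlgebra

variable {S : Type*} [CommRing S]

/-- **`R/(x)` regular forces `x ∉ 𝔪²`** (Matsumura Thm. 14.2 and the Remark after it): in a regular local ring, a non-zero
`x ∈ 𝔪` with regular local quotient `R/(x)` is part of a regular system of parameters (`dim R/(x) + 1 ≤ dim R` because
`x` is a non-zero-divisor of the domain `R`). [cite: Matsumura1987, Thm. 14.2] -/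
theorem not_mem_sq_of_isRegularLocalRing_quotient [IsRegularLocalRing S] {x : S} (hx : x ∈ maximalIdeal S)
    (hx0 : x ≠ 0) (hreg : IsRegularLocalRing (S ⧸ Ideal.span {x})) : x ∉ maximalIdeal S ^ 2 := by
  classical
  haveI : IsDomain S := isDomain_of_isRegularLocalRing S
  have hrange : Set.range (fun _ : Fin 1 => x) = {x} := Set.range_const
  haveI : IsRegularLocalRing (S ⧸ Ideal.span (Set.range fun _ : Fin 1 => x)) := by
    rw [hrange]
    exact hreg
  refine (IsRsopPart.of_isRegularLocalRing_quotient (z := fun _ : Fin 1 => x) (fun _ => hx) ?_).not_mem_sq 0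
  rw [hrange, Nat.cast_one]
  exact ringKrullDim_quotient_succ_le_of_nonZeroDivisor (mem_nonZeroDivisors_of_ne_zero hx0)

/-- **The graded lemma (characteristic 2).** In a regular local ring `S` of characteristic `2`, let `x ∈ 𝔪 ∖ 𝔪²` and
`x·ρ + w² ∈ 𝔪³`. Then `w ≡ μ·x` and `ρ ≡ μ²·x (mod 𝔪²)` for some `μ ∈ S`. In `S/(x)` (regular local, Matsumura 14.2)
`w̄² ∈ 𝔪̄³` forces `w̄ ∈ 𝔪̄²` (the order is additive, Zariski–Samuel VIII §1), i.e. `w = m + μx` with `m ∈ 𝔪²`; then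
`x·(ρ − μ²x) = (xρ + w²) − m² ∈ 𝔪³` (characteristic `2`) and additivity again give `ρ − μ²x ∈ 𝔪²`.
[cite: ZariskiSamuel1960, Ch. VIII §1 Thm. 1] [cite: Matsumura1987, Thm. 14.2] -/
theorem exists_sub_mul_mem_sq [IsRegularLocalRing S] [CharP S 2] {x ρ w : S} (hx : x ∈ maximalIdeal S)
    (hx2 : x ∉ maximalIdeal S ^ 2) (h : x * ρ + w ^ 2 ∈ maximalIdeal S ^ 3) :
    ∃ μ : S, w - μ * x ∈ maximalIdeal S ^ 2 ∧ ρ - μ ^ 2 * x ∈ maximalIdeal S ^ 2 := by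
  classical
  set I : Ideal S := Ideal.span {x} with hI
  haveI hreg : IsRegularLocalRing (S ⧸ I) := (IsRegularLocalRing.quotient_span_singleton hx hx2).1
  have hmax : maximalIdeal (S ⧸ I) = (maximalIdeal S).map (Ideal.Quotient.mk I) :=
    maximalIdeal_quotient_eq_map I
  have hxI : Ideal.Quotient.mk I x = 0 :=
    Ideal.Quotient.eq_zero_iff_mem.mpr (Ideal.mem_span_singleton_self x)
  -- `w̄ ² ∈ 𝔪̄ ³`
  have h3 : Ideal.Quotient.mk I w ^ 2 ∈ maximalIdeal (S ⧸ I) ^ 3 := by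
    have h' : Ideal.Quotient.mk I (x * ρ + w ^ 2) ∈ (maximalIdeal S ^ 3).map (Ideal.Quotient.mk I) :=
      Ideal.mem_map_of_mem _ h
    rw [Ideal.map_pow, ← hmax, map_add, map_mul, map_pow, hxI, zero_mul, zero_add] at h'
    exact h'
  -- hence `w̄ ∈ 𝔪̄ ²` (additivity of the order in the regular local ring `S/(x)`)
  have hw2 : Ideal.Quotient.mk I w ∈ maximalIdeal (S ⧸ I) ^ 2 := by
    by_contra hnot
    have hnot' : Ideal.Quotient.mk I w ∉ maximalIdeal (S ⧸ I) ^ (1 + 1) := by simpa using hnot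
    have h1 := pow_not_mem_pow_of_not_mem_pow hnot' 2
    exact h1 (by simpa using h3)
  -- lift: `w = m + μ x`, `m ∈ 𝔪²`
  rw [hmax, ← Ideal.map_pow, Ideal.mem_map_iff_of_surjective _ Ideal.Quotient.mk_surjective] at hw2
  obtain ⟨m, hm, hmw⟩ := hw2
  rw [Ideal.Quotient.eq] at hmw
  obtain ⟨μ, hμ⟩ := Ideal.mem_span_singleton'.mp hmw
  have hw : w = m - μ * x := by linear_combination hμ
  refine ⟨-μ, ?_, ?_⟩
  · have e : w - -μ * x = m := by linear_combination hw
    rw [e]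
    exact hm
  · -- `x (ρ - μ² x) = (x ρ + w²) - m² ∈ 𝔪³`
    have htwo : (2 : S) = 0 := CharTwo.two_eq_zero
    have hm2 : m ^ 2 ∈ maximalIdeal S ^ 3 := by
      have hmm : m * m ∈ maximalIdeal S ^ 2 * maximalIdeal S ^ 2 := Ideal.mul_mem_mul hm hm
      rw [← pow_add, ← pow_two] at hmm
      exact Ideal.pow_le_pow_right (by norm_num) hmm
    have hx3 : x * (ρ - (-μ) ^ 2 * x) ∈ maximalIdeal S ^ 3 := by
      have e : x * (ρ - (-μ) ^ 2 * x) = (x * ρ + w ^ 2) - m ^ 2 := by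
        linear_combination (-(w + m - μ * x)) * hw + (m * μ * x - μ ^ 2 * x ^ 2) * htwo
      rw [e]
      exact sub_mem h hm2
    by_contra hnot
    have hx2' : x ∉ maximalIdeal S ^ (1 + 1) := by simpa using hx2
    have hnot' : ρ - (-μ) ^ 2 * x ∉ maximalIdeal S ^ (1 + 1) := by simpa using hnot
    exact mul_not_mem_pow_of_not_mem_pow hx2' hnot' (by simpa using hx3)

end LocalAlgebra

/-! ## §2 One HIGH point step: `f' = x·ρ + G²` with `ρ ∈ 𝔪²` -/

variable {K : Type} [Field K]

/-- **B13a-1′, core (one step).** One local blowing up `R ⊂ R'` of a regular local subring `R ⊆ K` (dominated by `O`)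
along `𝔪_R` with respect to `O`, `R'` regular, `char K = 2`; the strict step `s = x₀·s' + g` (`x₀` a least-value element of
`𝔪_R`, `g ∈ R`), `f = s² ∈ R`, `f' = s'² ∈ R'`, HIGH at both ends (`f − g₀² ∈ 𝔪_R³`, `f' − g₁² ∈ 𝔪_{R'}³`). Then every
least-value element `x` of `𝔪_R` is a regular parameter of `R'` and `f' = x·ρ + G²` with `ρ ∈ 𝔪_{R'}²`.
OURS (W4.1 engine, strat-2 STUBPLAN-B13 §B13a-1 D1). [cite: Matsumura1987, Thm. 14.2] [cite: NovacoskiSpivakovsky2014, Def. 2.11] -/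
theorem sq_eq_mul_add_sq_of_high [CharP K 2] (O : ValuationSubring K) {R R' : Subring K}
    [IsLocalRing R] [IsLocalRing R'] (hdom : SubringDominates R O.toSubring)
    (hbl : IsLocalBlowupAlong O R (maximalIdeal R) R')
    (hreg : IsRegularLocalRing R) (hreg' : IsRegularLocalRing R') {x₀ x g s s' : K}
    (hx₀ : (∃ hx₀R : x₀ ∈ R, (⟨x₀, hx₀R⟩ : R) ∈ maximalIdeal R) ∧ x₀ ≠ 0 ∧
      ∀ y : R, y ∈ maximalIdeal R → O.valuation (y : K) ≤ O.valuation x₀)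
    (hg : g ∈ R) (hstep : s = x₀ * s' + g) (hs : s ^ 2 ∈ R) (hs' : s' ^ 2 ∈ R')
    (h3 : ∃ g₀ : R, (⟨s ^ 2, hs⟩ : R) - g₀ ^ 2 ∈ maximalIdeal R ^ 3)
    (h3' : ∃ g₁ : R', (⟨s' ^ 2, hs'⟩ : R') - g₁ ^ 2 ∈ maximalIdeal R' ^ 3)
    (hx : (∃ hxR : x ∈ R, (⟨x, hxR⟩ : R) ∈ maximalIdeal R) ∧ x ≠ 0 ∧
      ∀ y : R, y ∈ maximalIdeal R → O.valuation (y : K) ≤ O.valuation x) :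
    ∃ (hxR' : x ∈ R') (ρ G : R'), ρ ∈ maximalIdeal R' ^ 2 ∧ (⟨x, hxR'⟩ : R') ∈ maximalIdeal R' ∧
      (⟨x, hxR'⟩ : R') ∉ maximalIdeal R' ^ 2 ∧ (⟨s' ^ 2, hs'⟩ : R') = ⟨x, hxR'⟩ * ρ + G ^ 2 := by
  classical
  obtain ⟨⟨hxR, hxm⟩, hx0, hmax⟩ := hx
  obtain ⟨⟨hx₀R, hx₀m⟩, hx₀0, hmax₀⟩ := hx₀
  haveI := hreg
  haveI := hreg'
  have hRO : R ≤ O.toSubring := hdom.1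
  have hQT : IsQuadraticTransformAlong O R R' := ⟨‹_›, hbl⟩
  have hle : R ≤ R' := hQT.le
  have hR'O : R' ≤ O.toSubring := hQT.target_le
  have hdom' : SubringDominates R' O.toSubring := hQT.dominated
  -- the chart of `x`
  have hR' : R' = locAtCentre (blowupRing R x) O := eq_locAtCentre_blowupRing hbl hxR hxm hx0 hmax
  have hval : ∀ a : R, a ∈ maximalIdeal R ↔ O.valuation (a : K) < 1 :=
    (subringDominates_valuationSubring_iff hRO).mp hdom
  have hval' : ∀ a : R', a ∈ maximalIdeal R' ↔ O.valuation (a : K) < 1 :=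
    (subringDominates_valuationSubring_iff hR'O).mp hdom'
  have hxR' : x ∈ R' := hle hxR
  have hvx : O.valuation x < 1 := (hval ⟨x, hxR⟩).mp hxm
  have hdiv : ∀ y : R, y ∈ maximalIdeal R → (y : K) / x ∈ R' := fun y hy => by
    rw [hR']
    exact le_locAtCentre _ O (div_mem_blowupRing x hy)
  refine ⟨hxR', ?_⟩
  set x' : R' := ⟨x, hxR'⟩ with hx'def
  set f' : R' := ⟨s' ^ 2, hs'⟩ with hf'def
  set P : Ideal R' := Ideal.span {x'} with hPdef
  have hx'm : x' ∈ maximalIdeal R' := (hval' x').mpr hvx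
  have hx'0 : x' ≠ 0 := fun h => hx0 (congrArg Subtype.val h)
  -- `x ∉ 𝔪_R²`, `R'/(x)` regular local, hence `x ∉ 𝔪_{R'}²`
  have hx2 : (⟨x, hxR⟩ : R) ∉ maximalIdeal R ^ 2 :=
    QuadraticStep.not_mem_sq_of_forall_valuation_le hdom (u₀ := ⟨x, hxR⟩) hx0 hmax
  haveI hCreg : IsRegularRing (blowupRing R x ⧸
      Ideal.span {(⟨x, le_blowupRing R x hxR⟩ : blowupRing R x)}) :=
    isRegularRing_blowupRing_quotient R hxR hxm hx2 hx0
  have hCO : blowupRing R x ≤ O.toSubring :=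
    (le_locAtCentre _ O).trans (le_of_eq_of_le hR'.symm hR'O)
  have hregP : IsRegularLocalRing (R' ⧸ P) := by
    have h := isRegularLocalRing_locAtCentre_quotient hCO ⟨x, le_blowupRing R x hxR⟩ hvx
    have key : ∀ (T : Subring K) (hT : T = locAtCentre (blowupRing R x) O) (hxT : x ∈ T),
        IsRegularLocalRing (T ⧸ Ideal.span {(⟨x, hxT⟩ : T)}) := by
      intro T hT hxT
      subst hT
      exact h
    exact key R' hR' hxR'
  have hx'2 : x' ∉ maximalIdeal R' ^ 2 := not_mem_sq_of_isRegularLocalRing_quotient hx'm hx'0 hregP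
  -- `c = x₀ / x` is a unit of `R'`
  have hcR' : x₀ / x ∈ R' := hdiv ⟨x₀, hx₀R⟩ hx₀m
  set c : R' := ⟨x₀ / x, hcR'⟩ with hcdef
  have hvxx : O.valuation x₀ = O.valuation x :=
    le_antisymm (hmax ⟨x₀, hx₀R⟩ hx₀m) (hmax₀ ⟨x, hxR⟩ hxm)
  have hvc : O.valuation (x₀ / x) = 1 := by
    rw [map_div₀, hvxx, div_self ((map_ne_zero _).mpr hx0)]
  have hcu : IsUnit c := by
    by_contra hnu
    have hcm : c ∈ maximalIdeal R' := (IsLocalRing.mem_maximalIdeal c).mpr (mem_nonunits_iff.mpr hnu)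
    have hlt := (hval' c).mp hcm
    change O.valuation (x₀ / x) < 1 at hlt
    rw [hvc] at hlt
    exact lt_irrefl _ hlt
  obtain ⟨d, hd⟩ := hcu.exists_left_inv
  -- the strict step in the chart of `x`: `s = x·(c s') + g`
  have hsq : s ^ 2 = x ^ 2 * ((x₀ / x) * s') ^ 2 + g ^ 2 := by
    have e : x * ((x₀ / x) * s') = x₀ * s' := by field_simp
    rw [hstep, ← e, CharTwo.add_sq, mul_pow]
  -- `f − g₀² = h · x³` in `R'`
  obtain ⟨g₀, hg₀⟩ := h3
  have hmapm : Ideal.map (Subring.inclusion hle) (maximalIdeal R) ≤ P := by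
    rw [Ideal.map_le_iff_le_comap]
    intro y hy
    rw [Ideal.mem_comap, hPdef, Ideal.mem_span_singleton']
    refine ⟨⟨(y : K) / x, hdiv y hy⟩, Subtype.ext ?_⟩
    change (y : K) / x * x = y
    rw [div_mul_cancel₀ _ hx0]
  have h3P : Subring.inclusion hle ((⟨s ^ 2, hs⟩ : R) - g₀ ^ 2) ∈ P ^ 3 := by
    refine Ideal.pow_right_mono hmapm 3 ?_
    rw [← Ideal.map_pow]
    exact Ideal.mem_map_of_mem _ hg₀
  rw [hPdef, Ideal.span_singleton_pow, Ideal.mem_span_singleton'] at h3P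
  obtain ⟨h, hh⟩ := h3P
  have hhK : (h : K) * x ^ 3 = s ^ 2 - (g₀ : K) ^ 2 := by
    have e := congrArg Subtype.val hh
    simpa [Subring.coe_mul, Subring.coe_pow] using e
  -- `(g − g₀)² = x² · w` with `w = h x − c² f' ∈ R'`
  set w : R' := h * x' - c ^ 2 * f' with hwdef
  have hwK : (w : K) = (h : K) * x - (x₀ / x) ^ 2 * s' ^ 2 := by
    simp [hwdef, hx'def, hf'def, hcdef, Subring.coe_mul]
  have hu2 : ((g : K) - (g₀ : K)) ^ 2 = x ^ 2 * (w : K) := by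
    rw [sub_pow_char (R := K) g (g₀ : K), hwK]
    linear_combination -hsq - hhK
  -- `g − g₀ ∈ 𝔪_R` (valuations), hence `G₀ := (g − g₀)/x ∈ R'`
  set u : R := ⟨g, hg⟩ - g₀ with hudef
  have huK : (u : K) = g - (g₀ : K) := by simp [hudef]
  have hum : u ∈ maximalIdeal R := by
    rw [hval u]
    by_contra hvu
    have hvu1 : O.valuation (u : K) = 1 :=
      le_antisymm ((O.valuation_le_one_iff _).mpr (hRO u.2)) (not_lt.mp hvu)
    have hvw : O.valuation (w : K) ≤ 1 := (O.valuation_le_one_iff _).mpr (hR'O w.2)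
    have hlt : O.valuation (x ^ 2 * (w : K)) < 1 := by
      rw [map_mul, map_pow]
      calc O.valuation x ^ 2 * O.valuation (w : K) ≤ O.valuation x ^ 2 * 1 :=
            mul_le_mul' le_rfl hvw
        _ < 1 := by
          rw [mul_one]
          exact pow_lt_one₀ zero_le hvx two_ne_zero
    rw [← hu2, map_pow, ← huK, hvu1, one_pow] at hlt
    exact lt_irrefl _ hlt
  set G₀ : R' := ⟨(u : K) / x, hdiv u hum⟩ with hG₀def
  have hG₀x : (G₀ : K) * x = g - (g₀ : K) := by
    change (u : K) / x * x = _
    rw [div_mul_cancel₀ _ hx0, huK]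
  have hG₀2 : (G₀ : K) ^ 2 = (w : K) := by
    have h1 : ((G₀ : K) * x) ^ 2 = x ^ 2 * (w : K) := by rw [hG₀x, hu2]
    have hx2K : (x : K) ^ 2 ≠ 0 := pow_ne_zero 2 hx0
    apply mul_left_cancel₀ hx2K
    rw [← h1]
    ring
  -- in `R'`: `c² f' = x·h + G₀²` (characteristic 2)
  have htwo : (2 : K) = 0 := CharTwo.two_eq_zero
  have hS : c ^ 2 * f' = x' * h + G₀ ^ 2 := by
    apply Subtype.ext
    change (x₀ / x) ^ 2 * s' ^ 2 = x * (h : K) + (G₀ : K) ^ 2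
    rw [hG₀2, hwK]
    linear_combination ((x₀ / x) ^ 2 * s' ^ 2 - (h : K) * x) * htwo
  -- HIGH at the target, transported to `c² f'`: `x·h + (G₀ − c g₁)² ∈ 𝔪'³`
  obtain ⟨g₁, hg₁⟩ := h3'
  have hI3 : x' * h + (G₀ - c * g₁) ^ 2 ∈ maximalIdeal R' ^ 3 := by
    have h1 : c ^ 2 * (f' - g₁ ^ 2) ∈ maximalIdeal R' ^ 3 := Ideal.mul_mem_left _ _ hg₁
    have h2 : c ^ 2 * (f' - g₁ ^ 2) = x' * h + (G₀ - c * g₁) ^ 2 := by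
      rw [sub_pow_char (R := R') G₀ (c * g₁)]
      linear_combination hS
    rw [← h2]
    exact h1
  -- the graded lemma: move `μ² x²` into the square
  obtain ⟨μ, -, hρ⟩ := exists_sub_mul_mem_sq hx'm hx'2 hI3
  refine ⟨d ^ 2 * (h - μ ^ 2 * x'), d * (μ * x' + G₀), Ideal.mul_mem_left _ _ hρ, hx'm, hx'2, ?_⟩
  have htwo' : (2 : R') = 0 := CharTwo.two_eq_zero
  linear_combination d ^ 2 * hS - (d * c + 1) * f' * hd - (d ^ 2 * μ * x' * G₀) * htwo'

/-! ## §3 Run-indexed form (the shape of the skeleton's binders, unfolded) -/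

/-- **B13a-1′ along a run (literal shape).** For a sequence of local subrings `R j ⊆ K` (each the local ring at the centre
of `O` on some `B ⊆ O`, all regular) and torsor generators `s j`, `char K = 2`: if stage `i` is a POINT step
(`R (i+1)` = local blowing up of `R i` along `𝔪_{R i}`; strict step `s i = x₀·s (i+1) + g` with `x₀` an exceptional
parameter along `𝔪_{R i}`), HIGH at `i` and at `i+1` (a cleaning of `s j ²` in `𝔪³`), then for every exceptional parameter
`x` of stage `i`: `x ∈ 𝔪_{i+1} ∖ 𝔪_{i+1}²` and `s (i+1)² = x·ρ + G²` with `ρ ∈ 𝔪_{i+1}²`. The binders are the bodies of the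
skeleton's `IsLocalBlowupAlong`-step / `IsStrictStepAlong` / `IsExcParamAlong` / `IsHighOrderAt` at a point step
(`P i = 𝔪`); the holder's by-name leaf `highPointStep_decomposition_two` is the 8-line adapter. OURS (W4.1 engine).
[cite: Matsumura1987, Thm. 14.2] [cite: NovacoskiSpivakovsky2014, Def. 2.11] -/
theorem highPointStep_decomposition_pointStep [CharP K 2] (O : ValuationSubring K) (R : ℕ → Subring K)
    (s : ℕ → K) (i : ℕ) [IsLocalRing (R i)] [IsLocalRing (R (i + 1))]
    (hR : ∀ j, ∃ B : Subring K, B ≤ O.toSubring ∧ R j = locAtCentre B O)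
    (hreg : ∀ j, IsRegularLocalRing (R j))
    (hbl : IsLocalBlowupAlong O (R i) (maximalIdeal (R i)) (R (i + 1)))
    (hstrict : ∃ x₀ g : K, ((∃ hx : x₀ ∈ R i, (⟨x₀, hx⟩ : R i) ∈ maximalIdeal (R i)) ∧ x₀ ≠ 0 ∧
        ∀ y : R i, y ∈ maximalIdeal (R i) → O.valuation (y : K) ≤ O.valuation x₀) ∧
      g ∈ R i ∧ s i = x₀ * s (i + 1) + g)
    (hhigh : ∃ (hs : s i ^ 2 ∈ R i) (g : R i), (⟨s i ^ 2, hs⟩ : R i) - g ^ 2 ∈ maximalIdeal (R i) ^ (2 + 1))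
    (hhigh' : ∃ (hs : s (i + 1) ^ 2 ∈ R (i + 1)) (g : R (i + 1)),
      (⟨s (i + 1) ^ 2, hs⟩ : R (i + 1)) - g ^ 2 ∈ maximalIdeal (R (i + 1)) ^ (2 + 1))
    (x : K) (hx : (∃ hx : x ∈ R i, (⟨x, hx⟩ : R i) ∈ maximalIdeal (R i)) ∧ x ≠ 0 ∧
      ∀ y : R i, y ∈ maximalIdeal (R i) → O.valuation (y : K) ≤ O.valuation x) :
    ∃ (hs : s (i + 1) ^ 2 ∈ R (i + 1)) (hx₁ : x ∈ R (i + 1)) (ρ G : R (i + 1)),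
      ρ ∈ maximalIdeal (R (i + 1)) ^ 2 ∧ (⟨x, hx₁⟩ : R (i + 1)) ∈ maximalIdeal (R (i + 1)) ∧
        (⟨x, hx₁⟩ : R (i + 1)) ∉ maximalIdeal (R (i + 1)) ^ 2 ∧
        (⟨s (i + 1) ^ 2, hs⟩ : R (i + 1)) = ⟨x, hx₁⟩ * ρ + G ^ 2 := by
  obtain ⟨B, hBO, hRi⟩ := hR i
  have hdom : SubringDominates (R i) O.toSubring := by
    rw [hRi]
    exact subringDominates_locAtCentre hBO
  obtain ⟨x₀, g, hx₀, hg, hstep⟩ := hstrict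
  obtain ⟨hs, g₀, hg₀⟩ := hhigh
  obtain ⟨hs', g₁, hg₁⟩ := hhigh'
  obtain ⟨hx₁, ρ, G, h⟩ := sq_eq_mul_add_sq_of_high O hdom hbl (hreg i) (hreg (i + 1)) hx₀ hg hstep hs hs'
    ⟨g₀, hg₀⟩ ⟨g₁, hg₁⟩ hx
  exact ⟨hs', hx₁, ρ, G, h⟩

end Summit.ResolutionOfSingularities.ResolutionOfSingularities.Theorems.SwitchingDichotomy.HighPointStep

end
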